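import Literature.MathematicalPhysics.QuantumFieldTheory.Balaban1983to89.B8Ineq129
import Literature.MathematicalPhysics.QuantumFieldTheory.Balaban1983to89.B7Prop1Local

/-!
# `Balaban1983to89.B8Ineq130` — B8 Sect. F (1.130) (with (1.128)): the descent "Applying Lemma 1 many times, as in
# the proof of (1.65), (1.66)" through the tower of cubes `□̃^{(j)}`, `j = k, …, 0`, kernel-checked for non-abelian
# gauge fields, with the LOCAL carrier ((1.7) on the cube `□̃` only)

T. Bałaban, *Spaces of regular gauge field configurations on a lattice and gauge fixing conditions*, Commun.
Math. Phys. **99** (1985) 75–102 `[Balaban1985RegularSpaces]` ("B8"), Sect. F, pp. 98–99; it uses Lemma 1 of the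
same paper (p. 79) and Proposition 2 of T. Bałaban, *Averaging operations for lattice gauge theories*, Commun.
Math. Phys. **98** (1985) 17–51 `[Balaban1985Averaging]` ("B7", "[3]" in B8).  STATUS: a published, refereed
paper; this file REPRODUCES one printed step (statement-level typing + kernel proof of the printed argument from
the tree's certified forms of Lemma 1, Prop. 2 and (1.129)); nothing here is new mathematics and nothing here is a
claim about the Clay problem.

## THE PRINTED TEXT (quoted from the page images)

* p. 78 (1.15), the (block) axial gauge: "An axial gauge is defined by the equations: for `x_j ∈ Λ_j`, `j = 1, …,
  k`, we put `Ū^{j−1}(Γ_{x_j,x_{j−1}}) = 1` for `x_{j−1} ∈ B(x_j)`, `Ū^{j−2}(Γ_{x_{j−1},x_{j−2}}) = 1` for `x_{j−2} ∈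
  B(x_{j−1})`, …, `Ū(Γ_{x₂,x₁}) = 1` for `x₁ ∈ B(x₂)`, `U(Γ_{x₁,x}) = 1` for `x ∈ B(x₁)`. (1.15)"
* p. 79, Lemma 1: "Let `V₀`, `V′V₀` satisfy the condition (1.7) for `k = 1` and `L` arbitrary, and let
  `(R(V₀)V′)(Γ_{y,x}) = 1` for `x ∈ B(y)`, `|\overline{V′V₀} − V̄₀| < α₁` on `Ω₁^{(1)}`. (1.24)  Then for `α₀, α₁`
  small the configuration `V′` is also small, more precisely we have the bound `|V′ − 1| < 4d²α₀ + α₁` on `Ω₁`.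
  (1.25)" — certified for non-abelian fields in `B8Lemma1NonAbelian.lemma1_printedBound` (explicit smallness
  `α₀ ≤ 1/(6(d+1))`, `α₁ ≤ 1/6`).
* p. 87 (the mechanism referred to): "Let us take `j = k − 1` and let us apply Lemma 1 to `V₀ = Ū₀^{k−1}`, `V′V₀ =
  … = Ũ′^{k−1}Ū₀^{k−1}`. Of course all the assumptions are satisfied and we obtain `|V′ − 1| = |Ũ′^{k−1} − 1| <
  8d²α₀ + α₁`. We apply again the Lemma 1 to `V₀ = Ū₀^{k−2}`, … and the constant `α₁` replaced by `8d²α₀ + α₁`,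
  and we obtain `|Ũ′^{k−2} − 1| < 8d²α₀L^{−2} + 8d²α₀ + α₁`. Continuing these arguments we get `|Ũ′ʲ − 1| <
  8d²α₀L^{−2(k−j−1)} + … + 8d²α₀L^{−2} + 8d²α₀ + α₁ < 8d²α₀·1/(1 − L^{−2}) + α₁ < 11d²α₀ + α₁`."
* p. 98: "Let us take a sequence of cubes `□₀, □₁, …, □_{k−1}, □_k, □` … for every `j` the cube `□_j` is a sum of
  the big blocks of the lattice `T_{L^{−j}}`. … We cover `□₀` by a smallest family of cubes of the size `R₁M₁`. A
  sum of these cubes is a cube which we denote by `□̃`. … thus we have `□̃ ⊂ Ω_{k−1}`. … Let us consider the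
  configuration `U₀` on the cube `□̃`. By the assumptions (1.7)–(1.9) and Proposition 2 from [3] we have
  `|Ū₀ʲ(∂p) − 1| < 2α₀L²(Lʲη)²`, `p ⊂ □̃^{(j)}`, `j = 0, 1, …, k`. (1.128)  We apply a gauge transformation to
  `U₀`, such that the gauge transformed configuration `U₀′` satisfies the axial gauge conditions (1.15), and `Ū₀′ᵏ`
  satisfies the global axial gauge conditions on `□̃^{(k)}` …, i.e. `Ū₀′ᵏ(Γ_{y,x}) = 1` for `x ∈ □̃^{(k)}`, where
  `y` is a center of `□̃^{(k)}`. These last conditions imply `|Ū₀′ᵏ(x,x′) − 1| < |x − y|2L²α₀ ≤ (M +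
  4R₁M₁)dL²α₀`, `⟨x,x′⟩ ⊂ □̃^{(k)}`. (1.129)  We assume that `α₀` is so small that the number on the right-hand
  side above is still small and all the theorems on averaging operations are valid. In particular this means `α₀
  ≤ O(1)M⁻¹`, where `O(1)` has to be a small number. … Applying Lemma 1 many times, as in the proof of (1.65),
  (1.66)," — p. 99: "we get `|Ū₀′ʲ(x,x′) − 1| < 8d²L²(L^{−2(k−j−1)} + … + L^{−2} + 1)α₀ + (M + 4R₁M₁)dL²α₀ <
  11d²L²α₀ + 5dL²Mα₀ < 6dL²Mα₀`, `⟨x,x′⟩ ⊂ □̃^{(j)}`. (1.130)" … "(1.133) `|Ū₀″ʲ − 1| < 6dL²Mα₀` on `□_j^{(j)}`,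
  `j = 0, 1, …, k`, by the construction of `U₀″`, and the inequality (1.130)."

## WHAT IS CERTIFIED HERE (kernel, axioms `propext`/`Classical.choice`/`Quot.sound` only)

On the `ℤ^d` carriers of `B7Prop1Explicit`/`B7Prop2Explicit` (every lattice `Ω^{(j)}` is `ℤ^d`, the finer one is
its `L`-fold refinement, `Ūʲ = avgIter L U j` is the `j`-fold average (43) of [3]) and for bond fields with values
in a subgroup `G ≤ {|u| ≤ 1, |u⁻¹| ≤ 1}` of the units of a complete normed `ℂ`-algebra closed under the average
(42) (`B7Prop2Explicit.AvgClosed`; instances: the unitary group of a C⋆-algebra, `avgClosed_unitaryUnits`, and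
`SU(N)`, `B7Prop2SpecialUnitary`):
* `descent` — the abstract descent through a tower of cubes (`tlo`, `thi`): top-level bond bound `B_top` +
  plaquette bounds `a_n` per level + (1.15) between consecutive levels ⟹ `|Ū^{k−n}_b − 1| ≤ B_top + Σ_{m<n}
  4d²L²a_{m+1}` on the depth-`n` cube; one step = Lemma 1 with `V₀ = 1` on a pair of adjacent blocks
  (`step_cross` = `lemma1_printedBound`) or its interior half on one block (`step_interior` =
  `B8Lemma1NonAbelian.interior_bound`);
* `ineq128_global`, `ineq128_local` — (1.128) at every level from (1.7) on `Ω_{k−1}` (global sup form, resp. the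
  sup over the unit plaquettes of `□̃` only) via `B7Prop2Explicit.prop2_explicit_lt_two` /
  `B7Prop1Local.clampCfg`;
* `ineq130_global`, `ineq130_local`, `ineq130` — (1.130): first member with the printed constant
  `8d²L²(L^{−2(n−1)} + … + 1)α₀ + (M + 4R₁M₁)dL²α₀` (`bound130`; `≤` — see HONEST SCOPE), then `< 11d²L²α₀ +
  5dL²Mα₀ < 6dL²Mα₀` (`ineq130_members`: `Σ_{m<n} L^{−2m} ≤ 4/3 < 11/8` for `L ≥ 2`, `R₁M₁ ≤ M`, and `11d < M`
  which is EQUIVALENT to the last printed `<`, `B8.ineq130_iff`), for every depth `n ≤ k` and every bond of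
  `□̃^{(k−n)}`; the level-`k` input is the tree's (1.129) `B8Ineq129.ineq129` (gauge `u = 1`, i.e. applied to the
  already gauge-fixed `Ū₀′ᵏ`).

## DICTIONARY (print ↦ this file)

`η = L^{−k}`, level `j` ↦ depth `n = k − j`; `Lʲη = L^{−n}` ↦ `((L:ℝ)^n)⁻¹`; `□̃^{(j)}` ↦ the box `[tlo L lo n,
thi L hi n]` of the `j`-lattice `ℤ^d` with `tlo n = Lⁿ·lo`, `thi n = Lⁿ(hi + 𝟙) − 𝟙` (so `□̃^{(k)} = [lo, hi]` and
each cube is the union of the blocks over the coarser one — "compatible with the block structure"); `U₀′` ↦ `U`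
(ONE configuration carrying both (1.7) — gauge invariant — and the gauge conditions); `Ū₀′ʲ` ↦ `avgIter L U
(k − n)`; (1.7) on `Ω_{k−1} ⊃ □̃`, `|U(∂p) − 1| < α₀(L^{k−1}η)²·…` in the unit `η`: ↦ `pdev U < α₀L²(L^{−k})²`
(global) / `pdevOn (tlo k) (thi k) U < α₀L²(L^{−k})²` (local); (1.15) ↦ `axialFn (avgIter L U (k−(n+1))) (L•z)
(L•z + boxVec L r) = 1` for `z ∈ □̃^{(k−n)}`, `r ∈ [0,L)^d` (`Γ_{x_{j+1},x_j}` = the tree contour `treeWord` of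
`B7Prop1Explicit` from the corner `Lz` of the block `B(x_{j+1})`); global axial gauge with center `y` ↦ `hol
(avgIter L U k) y (treeWord (z − y)) = 1`, `|z − y|_∞ ≤ h`, `2h ≤ M + 4R₁M₁` (as in `B8Ineq129`); "`α₀` so small
that … all the theorems on averaging operations are valid" ↦ Prop. 1/2 smallness of [3] for `α₀L²` (`C₀α₀L² ≤ ⅓`,
`2α₀L² ≤ c₂′`, constants of `B7Prop2Explicit`) and `11d²L²α₀ + (M + 4R₁M₁)dL²α₀ ≤ 1/6` (Lemma 1's `α₁ ≤ 1/6`).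

## HONEST SCOPE (what is NOT certified here)

(i) The EXISTENCE of the gauge transformation producing (1.15) together with the global axial gauge on `□̃^{(k)}`
("It is easy to see that these equations together with (1.14) … determine uniquely an element in each orbit",
p. 78) is not typed: (1.15) and the global axial condition are HYPOTHESES on `U` (they are jointly satisfiable,
e.g. by `U = 1`, and the second engine constructs the transformation numerically).  (ii) The construction (1.131)–
(1.132) of `U₀″`, the membership `U₀″ ∈ 𝔄_k({□_j}, L³α₀) ∩ Ax_k(ℭ_k, 1)` ((1.8)–(1.9) involve covariant
derivatives of `∂U`, outside this vocabulary), Theorem 4 and (1.134)–(1.138) are not touched (cf. `B8.lean`,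
`B8Ineq129.ineq137_*` for (1.137)).  (iii) The first member of (1.130) is certified with `≤` where print has `<`
(the tree's (1.129) is a `≤`; the two further members are strict as printed, so (1.133)'s `< 6dL²Mα₀` holds
strictly: `ineq130`, last conjunct).  (iv) Print's (1.7) is pointwise strict; the hypothesis here bounds the
supremum strictly (equivalent on the finite cube `□̃`, marginally stronger in the global model) — as in
`B7Prop2Explicit`.  (v) Print's unspecified "`α₀` small", "`O(1)` small" are replaced by the explicit sufficient
conditions listed in the DICTIONARY; `M > 11d` is exactly what the last `<` of (1.130) requires.  (vi) Torus /
finite-`T` aspects (`Λ_j`, `𝔅_k`, (1.12)–(1.14)) are replaced by the cubes of the tower, which is all (1.130) is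
about.  Second engine (floating point, independent code path): `code/b2b-balaban-b08/g19/ineq130_check.py` of the
reconstruction packet (random `SU(2)` towers, `d = 2, 3`, `L = 2, 3`, `k = 2`: numerical gauge fixing to (1.15) +
global axial gauge, then the inequalities of `descent`/`step_cross`/`step_interior` and the exact rational
arithmetic of `ineq130_members`).
-/

noncomputable section

open scoped BigOperators
open NormedSpace Finset

namespace Literature.MathematicalPhysics.QuantumFieldTheory.Balaban1983to89.B8Ineq130

open B7Prop1Explicit B7Prop2Explicit B7Prop1Local MatrixLog B8Lemma1NonAbelian B8Ineq129
open B8Lemma1Lattice (InBlock)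

-- `Site` alone would resolve to the torus sites of `Setup.lean`; re-export the `ℤ^d` sites of `B7Prop1Explicit`.
export B7Prop1Explicit (Site)

variable {d : ℕ}

/-! ## §1 The tower of cubes `□̃^{(j)}`, `j = k, k − 1, …, 0`, indexed by the depth `n = k − j` -/

/-- Lower corner of the cube at depth `n` below the `k`-lattice cube `[lo, hi]`: `Lⁿ·lo` (in the coordinates of the
`(k − n)`-th lattice, header DICTIONARY of `B7Prop2Explicit`: every level is `ℤ^d`, the level below is the `L`-fold
refinement). [cite: Balaban1985RegularSpaces, p.98 ("for every j the cube □_j is a sum of the big blocks")] -/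
def tlo (L : ℕ) (lo : Site d) : ℕ → Site d
  | 0 => lo
  | n + 1 => (L : ℤ) • tlo L lo n

/-- Upper corner of the cube at depth `n`: `Lⁿ·(hi + 𝟙) − 𝟙` (the cube is a union of `Lⁿ`-blocks).
[cite: Balaban1985RegularSpaces, p.98 ("for every j the cube □_j is a sum of the big blocks")] -/
def thi (L : ℕ) (hi : Site d) : ℕ → Site d
  | 0 => hi
  | n + 1 => fun i => (L : ℤ) * (thi L hi n i + 1) - 1

/-- `tlo_zero` — bookkeeping. [folklore] -/
@[simp] theorem tlo_zero (L : ℕ) (lo : Site d) : tlo L lo 0 = lo := rfl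

/-- `thi_zero` — bookkeeping. [folklore] -/
@[simp] theorem thi_zero (L : ℕ) (hi : Site d) : thi L hi 0 = hi := rfl

/-- `tlo_succ` — bookkeeping. [folklore] -/
theorem tlo_succ (L : ℕ) (lo : Site d) (n : ℕ) : tlo L lo (n + 1) = (L : ℤ) • tlo L lo n := rfl

/-- `tlo_succ_apply` — bookkeeping. [folklore] -/
theorem tlo_succ_apply (L : ℕ) (lo : Site d) (n : ℕ) (i : Fin d) :
    tlo L lo (n + 1) i = (L : ℤ) * tlo L lo n i := by
  rw [tlo_succ, Pi.smul_apply, smul_eq_mul]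

/-- `thi_succ_apply` — bookkeeping. [folklore] -/
theorem thi_succ_apply (L : ℕ) (hi : Site d) (n : ℕ) (i : Fin d) :
    thi L hi (n + 1) i = (L : ℤ) * (thi L hi n i + 1) - 1 := rfl

/-- Closed form `tlo L lo n = Lⁿ·lo`. [folklore] -/
theorem tlo_apply (L : ℕ) (lo : Site d) : ∀ (n : ℕ) (i : Fin d), tlo L lo n i = (L : ℤ) ^ n * lo i
  | 0, i => by simp
  | n + 1, i => by rw [tlo_succ_apply, tlo_apply L lo n i, pow_succ]; ring

/-- Closed form `thi L hi n = Lⁿ·(hi + 𝟙) − 𝟙`. [folklore] -/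
theorem thi_apply (L : ℕ) (hi : Site d) : ∀ (n : ℕ) (i : Fin d), thi L hi n i = (L : ℤ) ^ n * (hi i + 1) - 1
  | 0, i => by simp
  | n + 1, i => by rw [thi_succ_apply, thi_apply L hi n i, pow_succ]; ring

/-- The cubes of the tower are non-empty when the top one is. [folklore] -/
theorem tlo_le_thi {L : ℕ} (hL : 1 ≤ L) {lo hi : Site d} (h : lo ≤ hi) :
    ∀ (n : ℕ) (i : Fin d), tlo L lo n i ≤ thi L hi n i
  | 0, i => by simpa using h i
  | n + 1, i => by
    have ih := tlo_le_thi hL h n i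
    have hL0 : (0 : ℤ) ≤ L := by positivity
    have hL1 : (1 : ℤ) ≤ L := by exact_mod_cast hL
    have h1 := mul_le_mul_of_nonneg_left ih hL0
    rw [tlo_succ_apply, thi_succ_apply]
    nlinarith

/-- **Block structure**: the `L`-block of a site `z` of the depth-`n` cube lies in the depth-`(n+1)` cube
(`B(z) = Lz + [0, L)^d`, B5 (1.6)). [cite: Balaban1985RegularSpaces, p.98 ("□_j is a sum of the big blocks")] -/
theorem block_mem {L : ℕ} {lo hi : Site d} {n : ℕ} {z : Site d} (hz : tlo L lo n ≤ z) (hz' : z ≤ thi L hi n)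
    (r : Fin d → Fin L) :
    tlo L lo (n + 1) ≤ (L : ℤ) • z + boxVec L r ∧ (L : ℤ) • z + boxVec L r ≤ thi L hi (n + 1) := by
  have hL0 : (0 : ℤ) ≤ L := by positivity
  constructor
  · intro i
    have h1 : tlo L lo n i ≤ z i := hz i
    have h2 := mul_le_mul_of_nonneg_left h1 hL0
    have hr : (0 : ℤ) ≤ boxVec L r i := by simp [boxVec]
    rw [tlo_succ_apply, Pi.add_apply, Pi.smul_apply, smul_eq_mul]
    linarith
  · intro i
    have h1 : z i ≤ thi L hi n i := hz' i
    have h2 := mul_le_mul_of_nonneg_left h1 hL0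
    have hr : boxVec L r i + 1 ≤ L := by have := (r i).isLt; simp only [boxVec]; omega
    rw [thi_succ_apply, Pi.add_apply, Pi.smul_apply, smul_eq_mul]
    linarith

/-- `smul_mem` — the corner `Lz` of the block. [folklore] -/
theorem smul_mem {L : ℕ} (hL : 1 ≤ L) {lo hi : Site d} {n : ℕ} {z : Site d} (hz : tlo L lo n ≤ z)
    (hz' : z ≤ thi L hi n) : tlo L lo (n + 1) ≤ (L : ℤ) • z ∧ (L : ℤ) • z ≤ thi L hi (n + 1) := by
  have h := block_mem hz hz' (fun _ => ⟨0, hL⟩)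
  have h0 : boxVec L (fun _ : Fin d => (⟨0, hL⟩ : Fin L)) = 0 := by funext i; simp [boxVec]
  rwa [h0, add_zero] at h

/-- **The two-block region of a coarse bond** `c = ⟨z, z + e_κ⟩` of the depth-`n` cube: `B(c₋) ∪ B(c₊) =
[Lz, Lz + pairTop L κ]` lies in the depth-`(n+1)` cube. [cite: Balaban1985RegularSpaces, (1.23) p.79, p.98] -/
theorem pair_mem {L : ℕ} {lo hi : Site d} {n : ℕ} {z : Site d} {κ : Fin d} (hz : tlo L lo n ≤ z)
    (hzκ : z + e κ ≤ thi L hi n) :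
    tlo L lo (n + 1) ≤ (L : ℤ) • z ∧ (L : ℤ) • z + pairTop L κ ≤ thi L hi (n + 1) := by
  have hL0 : (0 : ℤ) ≤ L := by positivity
  constructor
  · intro i
    have h1 : tlo L lo n i ≤ z i := hz i
    have h2 := mul_le_mul_of_nonneg_left h1 hL0
    rw [tlo_succ_apply, Pi.smul_apply, smul_eq_mul]
    exact h2
  · intro i
    have h1 : z i + e κ i ≤ thi L hi n i := hzκ i
    rw [thi_succ_apply, Pi.add_apply, Pi.smul_apply, smul_eq_mul, pairTop]
    by_cases hi : i = κ
    · subst hi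
      rw [e_apply_self] at h1
      have h2 := mul_le_mul_of_nonneg_left h1 hL0
      rw [if_pos rfl]
      linarith
    · rw [e_apply_of_ne hi, add_zero] at h1
      have h2 := mul_le_mul_of_nonneg_left h1 hL0
      rw [if_neg hi]
      linarith

/-- `bondHi_eq_pairTop` — bookkeeping: the box of `B7Prop1Local.bavg_congr` is the two-block region. [folklore] -/
theorem bondHi_eq_pairTop (L : ℕ) (q : Site d) (κ : Fin d) : bondHi L q κ = q + pairTop L κ := by
  funext i
  simp only [bondHi, Pi.add_apply, pairTop]
  split_ifs <;> ring

/-- The coarse site below a fine site: `fl L x = ⌊x / L⌋` coordinatewise. [folklore] -/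
def fl (L : ℕ) (x : Site d) : Site d := fun i => x i / (L : ℤ)

/-- `x ∈ B(L·fl L x)`. [folklore] -/
theorem inBlock_fl {L : ℕ} (hL : 1 ≤ L) (x : Site d) : InBlock L ((L : ℤ) • fl L x) x := by
  intro i
  have hLpos : (0 : ℤ) < L := by exact_mod_cast hL
  have h1 : x i % (L : ℤ) + x i / (L : ℤ) * L = x i := Int.emod_add_ediv_mul (x i) L
  have h2 := Int.emod_nonneg (x i) hLpos.ne'
  have h3 := Int.emod_lt_of_pos (x i) hLpos
  simp only [Pi.smul_apply, smul_eq_mul, fl]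
  constructor <;> linarith

/-- The coarse site below a site of the depth-`(n+1)` cube lies in the depth-`n` cube. [folklore] -/
theorem fl_mem {L : ℕ} (hL : 1 ≤ L) {lo hi : Site d} {n : ℕ} {x : Site d} (hx : tlo L lo (n + 1) ≤ x)
    (hx' : x ≤ thi L hi (n + 1)) : tlo L lo n ≤ fl L x ∧ fl L x ≤ thi L hi n := by
  have hL0 : (0 : ℤ) ≤ L := by positivity
  have hB := inBlock_fl hL x
  constructor
  · intro i
    have h1 : tlo L lo (n + 1) i ≤ x i := hx i
    have h2 := hB i
    rw [tlo_succ_apply] at h1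
    simp only [Pi.smul_apply, smul_eq_mul] at h2
    have h3 : (L : ℤ) * tlo L lo n i < (L : ℤ) * (fl L x i + 1) := by linarith
    have h4 : tlo L lo n i < fl L x i + 1 := lt_of_mul_lt_mul_left h3 hL0
    exact Int.lt_add_one_iff.mp h4
  · intro i
    have h1 : x i ≤ thi L hi (n + 1) i := hx' i
    have h2 := hB i
    rw [thi_succ_apply] at h1
    simp only [Pi.smul_apply, smul_eq_mul] at h2
    have h3 : (L : ℤ) * fl L x i < (L : ℤ) * (thi L hi n i + 1) := by linarith
    have h4 : fl L x i < thi L hi n i + 1 := lt_of_mul_lt_mul_left h3 hL0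
    exact Int.lt_add_one_iff.mp h4

/-- The coarse site below `x + e_ν` is the one below `x` or its `ν`-neighbour. [folklore] -/
theorem fl_add_e {L : ℕ} (hL : 1 ≤ L) (x : Site d) (ν : Fin d) :
    fl L (x + e ν) = fl L x ∨ fl L (x + e ν) = fl L x + e ν := by
  have hL0 : (0 : ℤ) ≤ L := by positivity
  have hLpos : (0 : ℤ) < L := by exact_mod_cast hL
  have hne : ∀ i, i ≠ ν → fl L (x + e ν) i = fl L x i := fun i hi => by
    simp only [fl, add_e_apply, if_neg hi, add_zero]
  have h1 := inBlock_fl hL x ν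
  have h2 := inBlock_fl hL (x + e ν) ν
  simp only [Pi.smul_apply, smul_eq_mul, add_e_apply, if_true] at h1 h2
  have h3 : (L : ℤ) * fl L x ν < (L : ℤ) * (fl L (x + e ν) ν + 1) := by linarith
  have h4 : (L : ℤ) * fl L (x + e ν) ν < (L : ℤ) * (fl L x ν + 1) + 1 := by linarith
  have h5 : fl L x ν < fl L (x + e ν) ν + 1 := lt_of_mul_lt_mul_left h3 hL0
  have h6 : (L : ℤ) * fl L (x + e ν) ν ≤ (L : ℤ) * (fl L x ν + 1) := Int.lt_add_one_iff.mp h4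
  have h7 : fl L (x + e ν) ν ≤ fl L x ν + 1 := le_of_mul_le_mul_left h6 hLpos
  rcases (show fl L (x + e ν) ν = fl L x ν ∨ fl L (x + e ν) ν = fl L x ν + 1 by omega) with h | h
  · left
    funext i
    by_cases hi : i = ν
    · subst hi; exact h
    · exact hne i hi
  · right
    funext i
    by_cases hi : i = ν
    · subst hi; rw [Pi.add_apply, e_apply_self, h]
    · rw [Pi.add_apply, e_apply_of_ne hi, add_zero]; exact hne i hi

/-- `le_smul_fl` — bookkeeping: `L·fl L x ≤ x`. [folklore] -/
theorem smul_fl_le {L : ℕ} (hL : 1 ≤ L) (x : Site d) : (L : ℤ) • fl L x ≤ x :=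
  fun i => ((inBlock_fl hL x) i).1

/-! ## §2 The configuration `V₀ = 1` (Lemma 1 is applied "to the pair of configurations 1, U₀′") -/

section One

variable {G : Type*} [Group G]

/-- Parallel transport of the configuration `1` is `1`. [folklore] -/
theorem hol_one : ∀ (x : Site d) (w : List (Letter d)), hol (1 : Site d → Fin d → G) x w = 1
  | x, [] => rfl
  | x, l :: w => by
    rw [hol_cons, hol_one (x + l.vec) w, mul_one]
    obtain ⟨μ, b⟩ := l
    cases b
    · rw [stepHol_false]; simp
    · rw [stepHol_true]; simp

/-- The axial gauge function of `1` is `1` (so (1.24) with `V₀ = 1` is (1.15): `U(Γ_{y,x}) = 1`). [folklore] -/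
theorem axialFn_one (y x : Site d) : axialFn (1 : Site d → Fin d → G) y x = 1 := hol_one _ _

/-- The trivial gauge transformation. [folklore] -/
theorem gaugeAct_one (W : Site d → Fin d → G) : gaugeAct (1 : Site d → G) W = W := by
  funext x μ; simp [gaugeAct]

/-- `V′ = U·1⁻¹ = U` (1.16) for `U₀ = 1`. [cite: Balaban1985RegularSpaces, (1.16) p.78] -/
theorem pert_one (U : Site d → Fin d → G) : pert U (1 : Site d → Fin d → G) = U := by
  funext x μ; simp [pert]

end One

section OneNormed

variable {𝔸 : Type*} [NormedRing 𝔸] [NormOneClass 𝔸]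

omit [NormOneClass 𝔸] in
/-- `1` satisfies every plaquette bound. [cite: Balaban1985RegularSpaces, p.98 ("identically equal to 1 satisfies,
of course, all possible regularity conditions")] -/
theorem plaqSmall_one {a : ℝ} (ha : 0 ≤ a) (lo hi : Site d) :
    B8Lemma1NonAbelian.PlaqSmall (1 : Site d → Fin d → 𝔸ˣ) lo hi a := fun x κ μ _ _ _ => by
  rw [hol_one]; simpa using ha

/-- `1` is `U1`-valued. [folklore] -/
theorem one_mem_U1 : ∀ (x : Site d) (κ : Fin d), (1 : Site d → Fin d → 𝔸ˣ) x κ ∈ U1 𝔸 :=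
  fun _ _ => one_mem _

variable [NormedAlgebra ℂ 𝔸] [CompleteSpace 𝔸]

omit [NormOneClass 𝔸] [NormedAlgebra ℂ 𝔸] [CompleteSpace 𝔸] in
/-- `V(Γ_{c,x})V(c)⁻¹ = 1` for `V = 1`. [folklore] -/
theorem Wcx_one (L : ℕ) (q : Site d) (κ : Fin d) (r : Site d) :
    Wcx L (1 : Site d → Fin d → 𝔸ˣ) q κ r = 1 := by
  simp [Wcx, hol_one]

omit [NormOneClass 𝔸] in
/-- **The average (42) of the configuration `1` is `1`** (so `|\overline{V′V₀} − V̄₀| = |Ū − 1|` for `V₀ = 1`).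
[cite: Balaban1985Averaging, (42) p.23] -/
theorem bavg_one (L : ℕ) (q : Site d) (κ : Fin d) : bavg L (1 : Site d → Fin d → 𝔸ˣ) q κ = 1 := by
  have hX : Xavg L (1 : Site d → Fin d → 𝔸ˣ) q κ = 0 := by
    simp [Xavg, Wcx_one, mlog_one]
  apply Units.ext
  simp [bavg, hX, hol_one]

end OneNormed

/-! ## §3 One application of Lemma 1 (with `V₀ = 1`) between two consecutive levels -/

section Step

variable {𝔸 : Type*} [NormedRing 𝔸] [NormOneClass 𝔸] [NormedAlgebra ℂ 𝔸] [CompleteSpace 𝔸]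

/-- **Lemma 1 for a crossing pair of blocks, `V₀ = 1`** (p. 79 (1.24)–(1.25) with `V₀ = 1`: if `W` satisfies (1.7)
for `k = 1` with `|W(∂p) − 1| ≤ a` on `B(c₋) ∪ B(c₊)`, `c = ⟨z, z + e_κ⟩` (unit-lattice corner `Lz`), the axial gauge
conditions (1.15) `W(Γ_{Lz,x}) = 1`, `x ∈ B(Lz)`, `W(Γ_{L(z+e_κ),x}) = 1`, `x ∈ B(L(z+e_κ))`, and `|W̄_c − 1| ≤ B`,
then `|W_b − 1| < 4d²(aL²) + B` for `b ⊂ B(c₋) ∪ B(c₊)`) — `B8Lemma1NonAbelian.lemma1_printedBound` with `V₀ = 1`,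
`α₀ = aL²`, `α₁ = B`. [cite: Balaban1985RegularSpaces, Lemma 1 (1.24)–(1.25) p.79] -/
theorem step_cross {L : ℕ} (hL : 1 ≤ L) {W : Site d → Fin d → 𝔸ˣ} (hW : ∀ x μ, W x μ ∈ U1 𝔸)
    {z : Site d} {κ : Fin d} {a B : ℝ}
    (hP : B8Lemma1NonAbelian.PlaqSmall W ((L : ℤ) • z) ((L : ℤ) • z + pairTop L κ) a)
    (hax : ∀ r : Fin d → Fin L, axialFn W ((L : ℤ) • z) ((L : ℤ) • z + boxVec L r) = 1)
    (hax₁ : ∀ r : Fin d → Fin L,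
      axialFn W ((L : ℤ) • (z + e κ)) ((L : ℤ) • (z + e κ) + boxVec L r) = 1)
    (havg : ‖(bavg L W ((L : ℤ) • z) κ : 𝔸) - 1‖ ≤ B)
    (ha : 0 < a) (ha' : a * (L : ℝ) ^ 2 ≤ 1 / (6 * ((d : ℝ) + 1))) (hB : 0 ≤ B) (hB' : B ≤ 1 / 6)
    (x : Site d) (ν : Fin d) (hx : InPair L ((L : ℤ) • z) κ x) (hxν : InPair L ((L : ℤ) • z) κ (x + e ν)) :
    ‖(W x ν : 𝔸) - 1‖ < 4 * (d : ℝ) ^ 2 * (a * (L : ℝ) ^ 2) + B := by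
  have hLne : (L : ℝ) ≠ 0 := by
    have : (L : ℝ) ≥ 1 := by exact_mod_cast hL
    positivity
  have hdiv : a * (L : ℝ) ^ 2 / (L : ℝ) ^ 2 = a := mul_div_cancel_right₀ a (pow_ne_zero 2 hLne)
  have H : Hyp L W 1 ((L : ℤ) • z) κ (a * (L : ℝ) ^ 2 / (L : ℝ) ^ 2) B := by
    refine ⟨hW, one_mem_U1, ?_, ?_, ?_, ?_, ?_⟩
    · rw [hdiv]; exact hP
    · rw [hdiv]; exact plaqSmall_one ha.le _ _
    · intro r; rw [hax r, axialFn_one]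
    · intro r; rw [← smul_add, hax₁ r, axialFn_one]
    · rw [bavg_one]; simpa using havg
  have h := lemma1_printedBound hL H (by positivity) ha' hB hB' x ν hx hxν
  rwa [pert_one] at h

omit [NormedAlgebra ℂ 𝔸] [CompleteSpace 𝔸] in
/-- **Interior bonds of one block, `V₀ = 1`** (p. 79: "The conditions `(R₀V′)(Γ_{y,x}) = 1, x ∈ B(y)`, imply
`V′_b = 1` for `b ⊂ Γ_{y,x}`. This and the above estimate imply `|V′_b − 1| < (d−1)(L−1)2α₀L⁻²` for `b ⊂ B(y)`"):
a bond with both ends in ONE block `B(Lz)` obeys `|W_b − 1| ≤ 2·dL·a` from the plaquettes and (1.15) alone (no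
average enters) — `B8Lemma1NonAbelian.interior_bound` with `V₀ = 1` and the count `Σ_{κ<ν} r_κ ≤ dL`.
[cite: Balaban1985RegularSpaces, p.79 (proof of Lemma 1)] -/
theorem step_interior {W : Site d → Fin d → 𝔸ˣ} (hW : ∀ x μ, W x μ ∈ U1 𝔸) {lo hi : Site d} {a : ℝ}
    (hP : B8Lemma1NonAbelian.PlaqSmall W lo hi a) (ha : 0 ≤ a) {L : ℕ} {z : Site d}
    (hlo : lo ≤ (L : ℤ) • z)
    (hax : ∀ r : Fin d → Fin L, axialFn W ((L : ℤ) • z) ((L : ℤ) • z + boxVec L r) = 1)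
    (x : Site d) (ν : Fin d) (r r' : Fin d → Fin L) (hx : x = (L : ℤ) • z + boxVec L r)
    (hx' : x + e ν = (L : ℤ) • z + boxVec L r') (hhi : x + e ν ≤ hi) :
    ‖(W x ν : 𝔸) - 1‖ ≤ 2 * ((d : ℝ) * L) * a := by
  have hyx : (L : ℤ) • z ≤ x := by rw [hx]; exact le_add_of_nonneg_right (boxVec_nonneg L r)
  have h := interior_bound W 1 hW one_mem_U1 hP (plaqSmall_one ha lo hi) ((L : ℤ) • z) x ν hlo hyx hhi
    (by rw [hx, hax r, axialFn_one]) (by rw [hx', hax r', axialFn_one])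
  rw [pert_one] at h
  refine h.trans ?_
  have hl : (l1 (lowPart ν (x - (L : ℤ) • z)) : ℝ) ≤ (d : ℝ) * L := by
    have h1 : l1 (lowPart ν (x - (L : ℤ) • z)) ≤ d * L := by
      rw [hx, add_sub_cancel_left, l1_lowPart_eq]
      calc ∑ κ, (if κ < ν then ((boxVec L r κ).natAbs) else 0) ≤ ∑ _κ : Fin d, L :=
            Finset.sum_le_sum fun κ _ => by
              have := (r κ).isLt
              split_ifs
              · simp only [boxVec, Int.natAbs_natCast]; omega
              · omega
        _ = d * L := by simp
    exact_mod_cast h1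
  nlinarith

end Step

/-! ## §4 "Applying Lemma 1 many times, as in the proof of (1.65), (1.66)" — the descent through the tower -/

section Descent

variable {𝔸 : Type*} [NormedRing 𝔸] [NormOneClass 𝔸] [NormedAlgebra ℂ 𝔸] [CompleteSpace 𝔸]

/-- **THE DESCENT** (p. 98 last sentence – p. 99 (1.130), mechanism of p. 87: "Let us take `j = k − 1` and let us
apply Lemma 1 … and we obtain `|V′ − 1| < 8d²α₀ + α₁`.  We apply again the Lemma 1 … and the constant `α₁` replaced
by `8d²α₀ + α₁` … Continuing these arguments we get `|Ũ′ʲ − 1| < 8d²α₀L^{−2(k−j−1)} + … + 8d²α₀ + α₁`"), abstract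
form over the tower of cubes: if every level `Ūʲ = avgIter L U j`, `j ≤ k`, is `{|u| ≤ 1, |u⁻¹| ≤ 1}`-valued, the
level of depth `n ≥ 1` has plaquette variables within `a_n` of `1` on its cube, the block axial gauge conditions
(1.15) hold between consecutive levels on the cubes, and the top level obeys `|Ūᵏ_b − 1| ≤ B_top` on the top cube
((1.129)), then — provided `a_n L² ≤ 1/(6(d+1))` and `B_top + Σ_{m<k} 4d²L²a_{m+1} ≤ 1/6` (Lemma 1's smallness
"for α₀, α₁ small") — `|Ū^{k−n}_b − 1| ≤ B_top + Σ_{m<n} 4d²L²a_{m+1}` for every bond `b` of the depth-`n` cube.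
One step = Lemma 1 with `V₀ = 1` on each pair of adjacent blocks (`step_cross`), or its interior half on one block
(`step_interior`, bound `2dL·a ≤ 4d²L²a`). [cite: Balaban1985RegularSpaces, p.98–99 (1.130); p.87 (proof of (1.65))] -/
theorem descent {L : ℕ} (hL : 1 ≤ L) (hd : 1 ≤ d) (lo hi : Site d) (U : Site d → Fin d → 𝔸ˣ) (k : ℕ)
    (a : ℕ → ℝ) (Btop : ℝ)
    (hmem : ∀ j ≤ k, ∀ x μ, avgIter L U j x μ ∈ U1 𝔸)
    (hplaq : ∀ n, 1 ≤ n → n ≤ k →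
      B8Lemma1NonAbelian.PlaqSmall (avgIter L U (k - n)) (tlo L lo n) (thi L hi n) (a n))
    (h15 : ∀ n, n < k → ∀ z, tlo L lo n ≤ z → z ≤ thi L hi n → ∀ r : Fin d → Fin L,
      axialFn (avgIter L U (k - (n + 1))) ((L : ℤ) • z) ((L : ℤ) • z + boxVec L r) = 1)
    (htop : ∀ x ν, lo ≤ x → x + e ν ≤ hi → ‖((avgIter L U k x ν : 𝔸ˣ) : 𝔸) - 1‖ ≤ Btop)
    (hBtop : 0 ≤ Btop)
    (ha : ∀ n, 1 ≤ n → n ≤ k → 0 < a n ∧ a n * (L : ℝ) ^ 2 ≤ 1 / (6 * ((d : ℝ) + 1)))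
    (htot : Btop + ∑ m ∈ Finset.range k, 4 * (d : ℝ) ^ 2 * (L : ℝ) ^ 2 * a (m + 1) ≤ 1 / 6) :
    ∀ n ≤ k, ∀ (x : Site d) (ν : Fin d), tlo L lo n ≤ x → x + e ν ≤ thi L hi n →
      ‖((avgIter L U (k - n) x ν : 𝔸ˣ) : 𝔸) - 1‖ ≤
        Btop + ∑ m ∈ Finset.range n, 4 * (d : ℝ) ^ 2 * (L : ℝ) ^ 2 * a (m + 1) := by
  have hterm : ∀ m, m + 1 ≤ k → 0 ≤ 4 * (d : ℝ) ^ 2 * (L : ℝ) ^ 2 * a (m + 1) := fun m hm => by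
    have := (ha (m + 1) (by omega) hm).1; positivity
  have hsum_nonneg : ∀ n ≤ k, 0 ≤ ∑ m ∈ Finset.range n, 4 * (d : ℝ) ^ 2 * (L : ℝ) ^ 2 * a (m + 1) :=
    fun n hn => Finset.sum_nonneg fun m hm => hterm m (by have := Finset.mem_range.mp hm; omega)
  have hsum_le : ∀ n ≤ k, ∑ m ∈ Finset.range n, 4 * (d : ℝ) ^ 2 * (L : ℝ) ^ 2 * a (m + 1) ≤
      ∑ m ∈ Finset.range k, 4 * (d : ℝ) ^ 2 * (L : ℝ) ^ 2 * a (m + 1) := fun n hn =>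
    Finset.sum_le_sum_of_subset_of_nonneg (Finset.range_mono hn)
      fun m hm _ => hterm m (by have := Finset.mem_range.mp hm; omega)
  intro n
  induction n with
  | zero =>
    intro _ x ν hx hxν
    simpa using htop x ν hx hxν
  | succ n ih =>
    intro hn x ν hx hxν
    have hn' : n ≤ k := by omega
    have hj : k - n = k - (n + 1) + 1 := by omega
    have hxhi : x ≤ thi L hi (n + 1) := le_of_add_e_le hxν
    have hxν' : tlo L lo (n + 1) ≤ x + e ν := hx.trans (le_add_of_nonneg_right (e_nonneg ν))
    obtain ⟨hz, hz'⟩ := fl_mem hL hx hxhi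
    obtain ⟨hw, hw'⟩ := fl_mem hL hxν' hxν
    have hbx := inBlock_fl hL x
    have hbx' := inBlock_fl hL (x + e ν)
    obtain ⟨r, hr⟩ := (inBlock_iff L _ x).mp hbx
    obtain ⟨r', hr'⟩ := (inBlock_iff L _ (x + e ν)).mp hbx'
    have hW := hmem (k - (n + 1)) (by omega)
    have hP := hplaq (n + 1) (by omega) hn
    obtain ⟨ha0, ha1⟩ := ha (n + 1) (by omega) hn
    have hB0 : 0 ≤ Btop + ∑ m ∈ Finset.range n, 4 * (d : ℝ) ^ 2 * (L : ℝ) ^ 2 * a (m + 1) := by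
      have := hsum_nonneg n hn'; linarith
    have hB1 : Btop + ∑ m ∈ Finset.range n, 4 * (d : ℝ) ^ 2 * (L : ℝ) ^ 2 * a (m + 1) ≤ 1 / 6 := by
      have := hsum_le n hn'; linarith
    have hax := h15 n (by omega) (fl L x) hz hz'
    rw [Finset.sum_range_succ, ← add_assoc]
    rcases fl_add_e hL x ν with hsame | hcross
    · -- both endpoints of the bond lie in the block `B(L·z)`, `z = fl L x`: the interior half of Lemma 1
      rw [hsame] at hr'
      have hb := step_interior hW hP ha0.le (smul_mem hL hz hz').1 hax x ν r r' hr hr' hxν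
      have hdL : 2 * ((d : ℝ) * L) * a (n + 1) ≤ 4 * (d : ℝ) ^ 2 * (L : ℝ) ^ 2 * a (n + 1) := by
        have hd1 : (1 : ℝ) ≤ d := by exact_mod_cast hd
        have hL1 : (1 : ℝ) ≤ L := by exact_mod_cast hL
        have hdL1 : (1 : ℝ) ≤ (d : ℝ) * L := by nlinarith
        have h2 : 2 * ((d : ℝ) * L) ≤ 4 * (d : ℝ) ^ 2 * (L : ℝ) ^ 2 := by nlinarith
        exact mul_le_mul_of_nonneg_right h2 ha0.le
      linarith
    · -- the bond crosses from `B(L·z)` to `B(L·(z + e_ν))`: Lemma 1 on the pair of blocks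
      rw [hcross] at hr' hw hw' hbx'
      have havg : ‖((bavg L (avgIter L U (k - (n + 1))) ((L : ℤ) • fl L x) ν : 𝔸ˣ) : 𝔸) - 1‖ ≤
          Btop + ∑ m ∈ Finset.range n, 4 * (d : ℝ) ^ 2 * (L : ℝ) ^ 2 * a (m + 1) := by
        have h := ih hn' (fl L x) ν hz hw'
        rwa [hj, avgIter_succ, rescale_apply] at h
      have hpm := pair_mem (lo := lo) (hi := hi) hz hw'
      rw [smul_add] at hbx'
      have hb := step_cross hL hW (hP.mono hpm.1 hpm.2) hax (h15 n (by omega) _ hw hw') havg ha0 ha1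
        hB0 hB1 x ν (Or.inl hbx) (Or.inr hbx')
      have h4 : 4 * (d : ℝ) ^ 2 * (a (n + 1) * (L : ℝ) ^ 2) = 4 * (d : ℝ) ^ 2 * (L : ℝ) ^ 2 * a (n + 1) := by
        ring
      linarith

end Descent

/-! ## §5 The scales `a_n = 2α₀L²(Lʲη)²`, `Lʲη = L^{−n}` (`η = L^{−k}`, `n = k − j`), and the printed arithmetic -/

section Scales

/-- The right side of (1.128) at depth `n = k − j`: `2α₀L²(Lʲη)² = 2α₀L²·L^{−2n}`.
[cite: Balaban1985RegularSpaces, (1.128) p.98] -/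
def aLev (α₀ : ℝ) (L n : ℕ) : ℝ := 2 * α₀ * (L : ℝ) ^ 2 * (((L : ℝ) ^ n)⁻¹) ^ 2

/-- The first right side of (1.130) at depth `n = k − j`:
`8d²L²(L^{−2(k−j−1)} + … + L^{−2} + 1)α₀ + (M + 4R₁M₁)dL²α₀`. [cite: Balaban1985RegularSpaces, (1.130) p.99] -/
def bound130 (d L : ℕ) (α₀ M R₁ M₁ : ℝ) (n : ℕ) : ℝ :=
  8 * (d : ℝ) ^ 2 * (L : ℝ) ^ 2 * α₀ * (∑ m ∈ Finset.range n, (((L : ℝ) ^ m)⁻¹) ^ 2) +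
    (M + 4 * R₁ * M₁) * d * (L : ℝ) ^ 2 * α₀

/-- `(L^{−n})² ≤ 1`. [folklore] -/
theorem pow_inv_sq_le_one {L : ℕ} (hL : 1 ≤ L) (n : ℕ) : (((L : ℝ) ^ n)⁻¹) ^ 2 ≤ 1 := by
  have h1 : (1 : ℝ) ≤ (L : ℝ) ^ n := one_le_pow₀ (by exact_mod_cast hL)
  have h2 : ((L : ℝ) ^ n)⁻¹ ≤ 1 := inv_le_one_of_one_le₀ h1
  have h3 : 0 ≤ ((L : ℝ) ^ n)⁻¹ := by positivity
  exact pow_le_one₀ h3 h2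

/-- `L²(L^{−n})² ≤ 1` for `n ≥ 1` (the scaled `α₀` of Lemma 1 at a lower level is not larger). [folklore] -/
theorem sq_mul_pow_inv_sq_le_one {L : ℕ} (hL : 1 ≤ L) {n : ℕ} (hn : 1 ≤ n) :
    (L : ℝ) ^ 2 * (((L : ℝ) ^ n)⁻¹) ^ 2 ≤ 1 := by
  have hL' : (1 : ℝ) ≤ L := by exact_mod_cast hL
  have hpos : (0 : ℝ) < (L : ℝ) ^ n := by positivity
  have h1 : (L : ℝ) ≤ (L : ℝ) ^ n := le_self_pow₀ hL' (by omega)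
  have h2 : (L : ℝ) * ((L : ℝ) ^ n)⁻¹ ≤ 1 := by
    rw [← div_eq_mul_inv]; exact div_le_one_of_le₀ h1 hpos.le
  have h3 : 0 ≤ (L : ℝ) * ((L : ℝ) ^ n)⁻¹ := by positivity
  calc (L : ℝ) ^ 2 * (((L : ℝ) ^ n)⁻¹) ^ 2 = ((L : ℝ) * ((L : ℝ) ^ n)⁻¹) ^ 2 := by ring
    _ ≤ 1 := pow_le_one₀ h3 h2

/-- `L²(L^{−(m+1)})² = (L^{−m})²`. [folklore] -/
theorem sq_mul_pow_inv_sq_succ {L : ℕ} (hL : 1 ≤ L) (m : ℕ) :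
    (L : ℝ) ^ 2 * (((L : ℝ) ^ (m + 1))⁻¹) ^ 2 = (((L : ℝ) ^ m)⁻¹) ^ 2 := by
  have hL' : (1 : ℝ) ≤ L := by exact_mod_cast hL
  have hLne : (L : ℝ) ≠ 0 := by positivity
  have hpow : (L : ℝ) ^ m ≠ 0 := pow_ne_zero m hLne
  field_simp
  ring

/-- `(L^{−n})²(L^{−(k−n)})² = (L^{−k})²`: (1.7) on `Ω_{k−1}` read at depth `n`. [folklore] -/
theorem pow_inv_sq_mul {L : ℕ} {n k : ℕ} (hn : n ≤ k) :
    (((L : ℝ) ^ n)⁻¹) ^ 2 * (((L : ℝ) ^ (k - n))⁻¹) ^ 2 = (((L : ℝ) ^ k)⁻¹) ^ 2 := by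
  rw [← mul_pow, ← mul_inv, ← pow_add, Nat.add_sub_cancel' hn]

/-- **The geometric series of (1.130)/(1.65)**: `L^{−2(n−1)} + … + L^{−2} + 1 ≤ 1/(1 − L^{−2}) ≤ 4/3` for
`L ≥ 2` (print p. 87: "`< 8d²α₀·1/(1 − L^{−2}) + α₁ < 11d²α₀ + α₁`"; cf. `B8.ineq165`).
[cite: Balaban1985RegularSpaces, p.87 (1.65), p.99 (1.130)] -/
theorem geom_sum_le {L : ℕ} (hL : 2 ≤ L) (n : ℕ) :
    ∑ m ∈ Finset.range n, (((L : ℝ) ^ m)⁻¹) ^ 2 ≤ 4 / 3 := by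
  have hL2 : (4 : ℝ) ≤ (L : ℝ) ^ 2 := by
    have : (2 : ℝ) ≤ L := by exact_mod_cast hL
    nlinarith
  have hr0 : 0 ≤ ((L : ℝ) ^ 2)⁻¹ := by positivity
  have hr1 : ((L : ℝ) ^ 2)⁻¹ ≤ 1 / 4 := by
    rw [inv_eq_one_div]; exact one_div_le_one_div_of_le (by norm_num) hL2
  have hterm : ∀ m, (((L : ℝ) ^ m)⁻¹) ^ 2 = (((L : ℝ) ^ 2)⁻¹) ^ m := fun m => by
    rw [inv_pow, inv_pow, ← pow_mul, ← pow_mul, mul_comm]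
  simp_rw [hterm]
  rw [geom_sum_eq (by linarith : ((L : ℝ) ^ 2)⁻¹ ≠ 1)]
  have h1 : 0 < 1 - ((L : ℝ) ^ 2)⁻¹ := by linarith
  have h2 : ((((L : ℝ) ^ 2)⁻¹) ^ n - 1) / (((L : ℝ) ^ 2)⁻¹ - 1) =
      (1 - (((L : ℝ) ^ 2)⁻¹) ^ n) / (1 - ((L : ℝ) ^ 2)⁻¹) := by
    rw [show (((L : ℝ) ^ 2)⁻¹) ^ n - 1 = -(1 - (((L : ℝ) ^ 2)⁻¹) ^ n) by ring,
      show ((L : ℝ) ^ 2)⁻¹ - 1 = -(1 - ((L : ℝ) ^ 2)⁻¹) by ring, neg_div_neg_eq]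
  rw [h2, div_le_iff₀ h1]
  have h3 := pow_nonneg hr0 n
  linarith

/-- `12(d+1) ≤ C₀ = 226(8(d+1)(d+4))²`: Prop. 1's smallness `C₀α₀ ≤ ⅓` is (much) stronger than Lemma 1's
"`α₀ small`". [folklore] -/
theorem twelve_le_C0 (d : ℕ) : 12 * ((d : ℝ) + 1) ≤ C0 d := by
  unfold C0
  have hd : (0 : ℝ) ≤ d := Nat.cast_nonneg d
  have h1 : 4 * ((d : ℝ) + 1) ≤ 8 * ((d : ℝ) + 1) * (d + 4) := by nlinarith
  have h2 : (1 : ℝ) ≤ 8 * ((d : ℝ) + 1) * (d + 4) := by nlinarith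
  have h3 : 8 * ((d : ℝ) + 1) * (d + 4) ≤ (8 * ((d : ℝ) + 1) * (d + 4)) ^ 2 := by nlinarith
  nlinarith

/-- Lemma 1's smallness of the scaled `α₀` from Prop. 1's: `C₀(α₀L²) ≤ ⅓ ⟹ 2α₀L² ≤ 1/(6(d+1))`. [folklore] -/
theorem two_mul_le_of_C0 {d : ℕ} {t : ℝ} (ht : 0 ≤ t) (h3 : C0 d * t ≤ 1 / 3) :
    2 * t ≤ 1 / (6 * ((d : ℝ) + 1)) := by
  have h := mul_le_mul_of_nonneg_right (twelve_le_C0 d) ht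
  rw [le_div_iff₀ (by positivity)]
  nlinarith

/-- `a_n L² ≤ 2α₀L²` for `n ≥ 1`. [folklore] -/
theorem aLev_mul_sq_le {L : ℕ} (hL : 1 ≤ L) {α₀ : ℝ} (hα : 0 ≤ α₀) {n : ℕ} (hn : 1 ≤ n) :
    aLev α₀ L n * (L : ℝ) ^ 2 ≤ 2 * (α₀ * (L : ℝ) ^ 2) := by
  have h := sq_mul_pow_inv_sq_le_one hL hn
  have h0 : 0 ≤ 2 * (α₀ * (L : ℝ) ^ 2) := by positivity
  calc aLev α₀ L n * (L : ℝ) ^ 2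
        = 2 * (α₀ * (L : ℝ) ^ 2) * ((L : ℝ) ^ 2 * (((L : ℝ) ^ n)⁻¹) ^ 2) := by unfold aLev; ring
    _ ≤ 2 * (α₀ * (L : ℝ) ^ 2) * 1 := mul_le_mul_of_nonneg_left h h0
    _ = 2 * (α₀ * (L : ℝ) ^ 2) := mul_one _

/-- The descent sum with `a_n = 2α₀L²·L^{−2n}` is the printed `8d²L²(Σ_{m<n} L^{−2m})α₀`. [folklore] -/
theorem descent_sum_eq {L : ℕ} (hL : 1 ≤ L) (d : ℕ) (α₀ : ℝ) (n : ℕ) :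
    ∑ m ∈ Finset.range n, 4 * (d : ℝ) ^ 2 * (L : ℝ) ^ 2 * aLev α₀ L (m + 1) =
      8 * (d : ℝ) ^ 2 * (L : ℝ) ^ 2 * α₀ * ∑ m ∈ Finset.range n, (((L : ℝ) ^ m)⁻¹) ^ 2 := by
  rw [Finset.mul_sum]
  refine Finset.sum_congr rfl fun m _ => ?_
  unfold aLev
  rw [← sq_mul_pow_inv_sq_succ hL m]
  ring

/-- **The last two members of (1.130)**: `8d²L²(Σ L^{−2m})α₀ + (M + 4R₁M₁)dL²α₀ < 11d²L²α₀ + 5dL²Mα₀ <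
6dL²Mα₀` — the first from `Σ ≤ 4/3` (`32/3 < 11`) and `R₁M₁ ≤ M` ("`M` is a multiple of `R₁M₁`", p. 98), the
second exactly when `11d < M` (`B8.ineq130_iff`; print: "`α₀ ≤ O(1)M⁻¹`", and `M = R₁M₁` with `R₁, M₁` "big",
so `M > 11d` is in force). [cite: Balaban1985RegularSpaces, (1.130) p.99] -/
theorem ineq130_members {d L : ℕ} (hd : 1 ≤ d) (hL : 2 ≤ L) {α₀ M R₁ M₁ : ℝ} (hα : 0 < α₀)
    (hRM : R₁ * M₁ ≤ M) (hM : 11 * (d : ℝ) < M) (n : ℕ) :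
    bound130 d L α₀ M R₁ M₁ n < 11 * (d : ℝ) ^ 2 * (L : ℝ) ^ 2 * α₀ + 5 * d * (L : ℝ) ^ 2 * M * α₀ ∧
      11 * (d : ℝ) ^ 2 * (L : ℝ) ^ 2 * α₀ + 5 * d * (L : ℝ) ^ 2 * M * α₀ < 6 * d * (L : ℝ) ^ 2 * M * α₀ := by
  have hd' : (0 : ℝ) < d := by exact_mod_cast hd
  have hL' : (0 : ℝ) < L := by exact_mod_cast lt_of_lt_of_le (by norm_num) hL
  have hS := geom_sum_le hL n
  have hpos : 0 < (d : ℝ) ^ 2 * (L : ℝ) ^ 2 * α₀ := by positivity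
  have hpos' : 0 < (d : ℝ) * (L : ℝ) ^ 2 * α₀ := by positivity
  refine ⟨?_, (B8.ineq130_iff hd' hL' hα).mpr hM⟩
  unfold bound130
  have h1 : 8 * (d : ℝ) ^ 2 * (L : ℝ) ^ 2 * α₀ * ∑ m ∈ Finset.range n, (((L : ℝ) ^ m)⁻¹) ^ 2 ≤
      8 * (d : ℝ) ^ 2 * (L : ℝ) ^ 2 * α₀ * (4 / 3) := mul_le_mul_of_nonneg_left hS (by positivity)
  have h5 : M + 4 * R₁ * M₁ ≤ 5 * M := by linarith
  have h2 : (M + 4 * R₁ * M₁) * d * (L : ℝ) ^ 2 * α₀ ≤ 5 * M * ((d : ℝ) * (L : ℝ) ^ 2 * α₀) := by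
    calc (M + 4 * R₁ * M₁) * d * (L : ℝ) ^ 2 * α₀ = (M + 4 * R₁ * M₁) * ((d : ℝ) * (L : ℝ) ^ 2 * α₀) := by ring
      _ ≤ 5 * M * ((d : ℝ) * (L : ℝ) ^ 2 * α₀) := mul_le_mul_of_nonneg_right h5 hpos'.le
  linarith

end Scales

/-! ## §6 (1.128) and (1.130), global carrier ((1.7) on all of `ℤ^d`) -/

section Global

variable {𝔸 : Type*} [NormedRing 𝔸] [NormOneClass 𝔸] [NormedAlgebra ℂ 𝔸] [CompleteSpace 𝔸]

/-- **(1.128)** p. 98 ("By the assumptions (1.7)–(1.9) and Proposition 2 from [3] we have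
`|Ū₀ʲ(∂p) − 1| < 2α₀L²(Lʲη)²`, `p ⊂ □̃^{(j)}`, `j = 0, 1, …, k`"), global model: if `U` is `G`-valued (`G` an
`AvgClosed` gauge group, e.g. `U(N)`), `L ≥ 2`, (1.7) on `Ω_{k−1} ⊃ □̃`: `sup_p |U(∂p) − 1| < α₀L²·L^{−2k}`
(`= α₀(L^{−(k−1)})²`, `η = L^{−k}`), and `α₀L²` is Prop.-1-small, then at depth `n = k − j ≤ k` the average
`Ūʲ = avgIter L U (k − n)` has ALL plaquette variables within `2α₀L²·L^{−2n} = 2α₀L²(Lʲη)²` of `1`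
(`B7Prop2Explicit.prop2_explicit_lt_two` at level `k − n` with `α₀L²L^{−2n}` for `α₀`), and every level is
`G`-valued. [cite: Balaban1985RegularSpaces, (1.128) p.98; Balaban1985Averaging, Prop. 2 (54) p.26] -/
theorem ineq128_global (L : ℕ) (hL : 2 ≤ L) {G : Subgroup 𝔸ˣ} (hG : AvgClosed d L G) (k : ℕ)
    (U : Site d → Fin d → 𝔸ˣ) (hU : ∀ x κ, U x κ ∈ G) {α₀ : ℝ} (hα : 0 < α₀)
    (hα3 : C0 d * (α₀ * (L : ℝ) ^ 2) ≤ 1 / 3) (hα2 : 2 * (α₀ * (L : ℝ) ^ 2) ≤ c2' d L)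
    (h17 : pdev U < α₀ * (L : ℝ) ^ 2 * (((L : ℝ) ^ k)⁻¹) ^ 2) (n : ℕ) (hn : n ≤ k) :
    pdev (avgIter L U (k - n)) < aLev α₀ L n ∧ ∀ j ≤ k - n, ∀ x μ, avgIter L U j x μ ∈ G := by
  have hL1 : 1 ≤ L := le_trans (by norm_num) hL
  have hq1 := pow_inv_sq_le_one hL1 n
  have hL' : (0 : ℝ) < L := by exact_mod_cast lt_of_lt_of_le (by norm_num) hL
  have hαpos : 0 < α₀ * (L : ℝ) ^ 2 * (((L : ℝ) ^ n)⁻¹) ^ 2 := by positivity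
  have hαle : α₀ * (L : ℝ) ^ 2 * (((L : ℝ) ^ n)⁻¹) ^ 2 ≤ α₀ * (L : ℝ) ^ 2 :=
    mul_le_of_le_one_right (by positivity) hq1
  have hα3' : C0 d * (α₀ * (L : ℝ) ^ 2 * (((L : ℝ) ^ n)⁻¹) ^ 2) ≤ 1 / 3 :=
    (mul_le_mul_of_nonneg_left hαle (C0_pos d).le).trans hα3
  have hα2' : 2 * (α₀ * (L : ℝ) ^ 2 * (((L : ℝ) ^ n)⁻¹) ^ 2) ≤ c2' d L :=
    (mul_le_mul_of_nonneg_left hαle (by norm_num)).trans hα2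
  have h52 : pdev U < α₀ * (L : ℝ) ^ 2 * (((L : ℝ) ^ n)⁻¹) ^ 2 * (((L : ℝ) ^ (k - n))⁻¹) ^ 2 := by
    rw [mul_assoc, pow_inv_sq_mul hn]; exact h17
  refine ⟨?_, (prop2_explicit L hL hG (k - n) U hU hαpos hα3' hα2' h52).2⟩
  calc pdev (avgIter L U (k - n)) < 2 * (α₀ * (L : ℝ) ^ 2 * (((L : ℝ) ^ n)⁻¹) ^ 2) :=
        prop2_explicit_lt_two L hL hG (k - n) U hU hαpos hα3' hα2' h52
    _ = aLev α₀ L n := by unfold aLev; ring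

/-- **(1.130), FIRST MEMBER, GLOBAL CARRIER** (p. 98 last sentence – p. 99: "Applying Lemma 1 many times, as in
the proof of (1.65), (1.66), we get `|Ū₀′ʲ(x,x′) − 1| < 8d²L²(L^{−2(k−j−1)} + … + L^{−2} + 1)α₀ +
(M + 4R₁M₁)dL²α₀`, `⟨x,x′⟩ ⊂ □̃^{(j)}`"), kernel-checked for non-abelian `G`-valued fields (`G` any gauge group
closed under the average (42), e.g. `U(N)`, `SU(N)`) on the `ℤ^d` model of the lattices: HYPOTHESES — `L ≥ 2`,
`d ≥ 1`; (1.7) on `Ω_{k−1} ⊃ □̃` in the global form `sup_p |U₀′(∂p) − 1| < α₀L²·L^{−2k}` (gauge invariant, so it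
is (1.7) for `U₀`); `α₀L²` Prop.-1-small (`C₀α₀L² ≤ ⅓`, `2α₀L² ≤ c₂′`); the block axial gauge conditions (1.15)
for `U₀′` between all consecutive levels on the tower of cubes `□̃^{(j)}` = `[tlo n, thi n]`, `n = k − j`
(`Ū₀′ʲ(Γ_{Lz,x}) = 1`, `x ∈ B(Lz)`, `z ∈ □̃^{(j+1)}`); the global axial gauge of `Ū₀′ᵏ` on `□̃^{(k)} = [lo, hi]`
with center `y` (`Ū₀′ᵏ(Γ_{y,x}) = 1`), `|x − y|_∞ ≤ h`, `2h ≤ M + 4R₁M₁`; and the printed smallness "α₀ is so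
small that the number on the right-hand side … is still small and all the theorems on averaging operations are
valid" as `11d²L²α₀ + (M + 4R₁M₁)dL²α₀ ≤ 1/6`.  CONCLUSION — for every `n ≤ k` and every bond `⟨x, x + e_ν⟩ ⊂
□̃^{(k−n)}`: `|Ū₀′^{k−n}(x, x + e_ν) − 1| ≤ 8d²L²(Σ_{m<n} L^{−2m})α₀ + (M + 4R₁M₁)dL²α₀` (`bound130`; `≤` where
print has `<`: the level-`k` input (1.129) is certified with `≤` in `B8Ineq129.ineq129`; the strict members are
`ineq130_members`).  Proof = the printed one: (1.128) at every level (`ineq128_global`), (1.129) at the top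
(`B8Ineq129.ineq129` with `u = 1`), then the descent `descent` (Lemma 1 with `V₀ = 1` level by level).
[cite: Balaban1985RegularSpaces, (1.130) p.99, (1.128)–(1.129) p.98, (1.15) p.78, Lemma 1 p.79] -/
theorem ineq130_global (L : ℕ) (hL : 2 ≤ L) (hd : 1 ≤ d) {G : Subgroup 𝔸ˣ} (hG : AvgClosed d L G) (k : ℕ)
    (U : Site d → Fin d → 𝔸ˣ) (hU : ∀ x κ, U x κ ∈ G) {α₀ : ℝ} (hα : 0 < α₀)
    (hα3 : C0 d * (α₀ * (L : ℝ) ^ 2) ≤ 1 / 3) (hα2 : 2 * (α₀ * (L : ℝ) ^ 2) ≤ c2' d L)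
    (h17 : pdev U < α₀ * (L : ℝ) ^ 2 * (((L : ℝ) ^ k)⁻¹) ^ 2)
    (lo hi : Site d)
    (h15 : ∀ n, n < k → ∀ z, tlo L lo n ≤ z → z ≤ thi L hi n → ∀ r : Fin d → Fin L,
      axialFn (avgIter L U (k - (n + 1))) ((L : ℤ) • z) ((L : ℤ) • z + boxVec L r) = 1)
    {y : Site d} {h : ℕ} (hy : lo ≤ y) (hy' : y ≤ hi) (hrad : ∀ κ, y κ - lo κ ≤ h ∧ hi κ - y κ ≤ h)
    (hgax : ∀ z, lo ≤ z → z ≤ hi → hol (avgIter L U k) y (treeWord (z - y)) = 1)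
    {M R₁ M₁ : ℝ} (hside : 2 * (h : ℝ) ≤ M + 4 * R₁ * M₁)
    (hsmall : 11 * (d : ℝ) ^ 2 * (L : ℝ) ^ 2 * α₀ + (M + 4 * R₁ * M₁) * d * (L : ℝ) ^ 2 * α₀ ≤ 1 / 6)
    (n : ℕ) (hn : n ≤ k) (x : Site d) (ν : Fin d) (hx : tlo L lo n ≤ x) (hxν : x + e ν ≤ thi L hi n) :
    ‖((avgIter L U (k - n) x ν : 𝔸ˣ) : 𝔸) - 1‖ ≤ bound130 d L α₀ M R₁ M₁ n := by
  have hL1 : 1 ≤ L := le_trans (by norm_num) hL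
  have h128 := fun m hm => ineq128_global L hL hG k U hU hα hα3 hα2 h17 m hm
  have hmemG := (h128 0 (Nat.zero_le k)).2
  have hmem : ∀ j ≤ k, ∀ x μ, avgIter L U j x μ ∈ U1 𝔸 := fun j hj x μ =>
    hG.le_U1 (hmemG j (by simpa using hj) x μ)
  have hW : ∀ x μ, avgIter L U k x μ ∈ U1 𝔸 := hmem k le_rfl
  have hpk : pdev (avgIter L U k) < 2 * α₀ * (L : ℝ) ^ 2 := by
    have h0 := (h128 0 (Nat.zero_le k)).1
    simpa [aLev] using h0
  have hP0 : B8Lemma1NonAbelian.PlaqSmall (avgIter L U k) lo hi (2 * α₀ * (L : ℝ) ^ 2) :=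
    plaqSmall_of_pdev hW hpk.le lo hi
  have hh : (0 : ℝ) ≤ 2 * (h : ℝ) := by positivity
  have hMpos : 0 ≤ M + 4 * R₁ * M₁ := hh.trans hside
  have htop : ∀ x ν, lo ≤ x → x + e ν ≤ hi →
      ‖((avgIter L U k x ν : 𝔸ˣ) : 𝔸) - 1‖ ≤ (M + 4 * R₁ * M₁) * d * (L : ℝ) ^ 2 * α₀ := by
    intro x ν hx hxν
    have h9 := ineq129 (avgIter L U k) hW hy hy' hrad hα.le hP0 1 (one_mem _)
      (fun z hz hz' => by rw [gaugeAct_one]; exact hgax z hz hz') hside x ν hx hxν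
    rw [gaugeAct_one] at h9
    exact h9.1.trans h9.2
  have hS := geom_sum_le hL k
  have h8 : 0 ≤ 8 * (d : ℝ) ^ 2 * (L : ℝ) ^ 2 * α₀ := by positivity
  have htot : (M + 4 * R₁ * M₁) * d * (L : ℝ) ^ 2 * α₀ +
      ∑ m ∈ Finset.range k, 4 * (d : ℝ) ^ 2 * (L : ℝ) ^ 2 * aLev α₀ L (m + 1) ≤ 1 / 6 := by
    rw [descent_sum_eq hL1]
    have := mul_le_mul_of_nonneg_left hS h8
    nlinarith
  have hdesc := descent hL1 hd lo hi U k (aLev α₀ L) ((M + 4 * R₁ * M₁) * d * (L : ℝ) ^ 2 * α₀) hmem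
    (fun m hm1 hmk => plaqSmall_of_pdev (hmem _ (by omega)) (h128 m hmk).1.le _ _) h15 htop
    (by positivity)
    (fun m hm1 _ => ⟨by have : (0 : ℝ) < L := by exact_mod_cast (lt_of_lt_of_le (by norm_num) hL)
                        unfold aLev; positivity,
      (aLev_mul_sq_le hL1 hα.le hm1).trans (two_mul_le_of_C0 (by positivity) hα3)⟩)
    htot n hn x ν hx hxν
  rw [descent_sum_eq hL1] at hdesc
  unfold bound130
  linarith

end Global

/-! ## §7 The local carrier: (1.7) on the cube `□̃` only (p. 98 "Let us consider the configuration `U₀` on the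
cube `□̃`") -/

section Local

variable {G : Type*} [Group G]

/-- `inBox_of_le` — bookkeeping: the coordinate box of `B7Prop1Local` from the product order. [folklore] -/
theorem inBox_of_le {lo hi x : Site d} (h1 : lo ≤ x) (h2 : x ≤ hi) : InBox lo hi x := fun i => ⟨h1 i, h2 i⟩

/-- LOCALITY OF THE AXIAL GAUGE FUNCTION `V(Γ_{y,x})` inside a box containing `y` and `x`. [folklore] -/
theorem axialFn_congr {lo hi : Site d} {V V' : Site d → Fin d → G} (h : AgreeOn lo hi V V') (y x : Site d)
    (hy : InBox lo hi y) (hx : InBox lo hi x) : axialFn V y x = axialFn V' y x := by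
  show hol V y (treeWord (x - y)) = hol V' y (treeWord (x - y))
  exact hol_treeWord_congr h y (x - y) hy (by rw [add_sub_cancel]; exact hx)

/-- LOCALITY OF A PLAQUETTE VARIABLE inside a box containing the plaquette. [folklore] -/
theorem hol_plaqWord_congr {lo hi : Site d} {V V' : Site d → Fin d → G} (h : AgreeOn lo hi V V') (z : Site d)
    (μ ν : Fin d) (hz : InBox lo hi z) (hz' : InBox lo hi (z + e μ + e ν)) :
    hol V z (plaqWord μ ν) = hol V' z (plaqWord μ ν) := by
  have hμ : InBox lo hi (z + e μ) := inBox_of_between hz hz' fun i => by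
    rw [add_e_apply, add_e_apply, add_e_apply]; split_ifs <;> omega
  have hν : InBox lo hi (z + e ν) := inBox_of_between hz hz' fun i => by
    rw [add_e_apply, add_e_apply, add_e_apply]; split_ifs <;> omega
  have hνμ : InBox lo hi (z + e ν + e μ) := by rw [add_right_comm]; exact hz'
  rw [hol_plaqWord_eq, hol_plaqWord_eq, h z μ hz hμ, h (z + e μ) ν hμ hz', h (z + e ν) μ hν hνμ, h z ν hz hν]

variable {𝔸 : Type*} [NormedRing 𝔸] [NormOneClass 𝔸] [NormedAlgebra ℂ 𝔸] [CompleteSpace 𝔸]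

omit [NormOneClass 𝔸] in
/-- LOCALITY OF ONE AVERAGING STEP ON THE TOWER: configurations agreeing on the bonds of the depth-`(n+1)` cube
have `k`-… one-step averages agreeing on the bonds of the depth-`n` cube (`B7Prop1Local.bavg_congr` on each
`B(c₋) ∪ B(c₊)`, which lies in the finer cube by `pair_mem`). [cite: Balaban1985Averaging, p.24 (locality of (42))] -/
theorem agree_step {L : ℕ} (hL : 1 ≤ L) {lo hi : Site d} {n : ℕ} {V V' : Site d → Fin d → 𝔸ˣ}
    (h : AgreeOn (tlo L lo (n + 1)) (thi L hi (n + 1)) V V') :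
    AgreeOn (tlo L lo n) (thi L hi n) (rescale L (bavg L V)) (rescale L (bavg L V')) := by
  intro q κ hq hqκ
  rw [rescale_apply, rescale_apply]
  have hpm := pair_mem (L := L) (lo := lo) (hi := hi) (z := q) (κ := κ) (fun i => (hq i).1) (fun i => (hqκ i).2)
  refine bavg_congr L hL _ κ (h.mono (fun i => hpm.1 i) fun i => ?_)
  rw [bondHi_eq_pairTop]
  exact hpm.2 i

omit [NormOneClass 𝔸] in
/-- LOCALITY OF THE ITERATED AVERAGE ON THE TOWER: agreement on the bonds of the depth-`(n + j)` cube gives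
agreement of the `j`-fold averages (43) on the bonds of the depth-`n` cube. [cite: Balaban1985Averaging, p.24] -/
theorem agree_level {L : ℕ} (hL : 1 ≤ L) {lo hi : Site d} {V V' : Site d → Fin d → 𝔸ˣ} :
    ∀ (j n : ℕ), AgreeOn (tlo L lo (n + j)) (thi L hi (n + j)) V V' →
      AgreeOn (tlo L lo n) (thi L hi n) (avgIter L V j) (avgIter L V' j)
  | 0, n, h => by simpa using h
  | j + 1, n, h => by
    rw [show n + (j + 1) = (n + 1) + j by omega] at h
    rw [avgIter_succ, avgIter_succ]
    exact agree_step hL (agree_level hL j (n + 1) h)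

/-- **(1.128), LOCAL CARRIER** — the printed setting "Let us consider the configuration `U₀` on the cube `□̃`.
By the assumptions (1.7)–(1.9) and Proposition 2 from [3] we have `|Ū₀ʲ(∂p) − 1| < 2α₀L²(Lʲη)²`, `p ⊂ □̃^{(j)}`,
`j = 0, 1, …, k`" with (1.7) assumed on the unit plaquettes of `□̃` ONLY (`B7Prop1Local.pdevOn` over the finest
cube `[tlo k, thi k]`): for every depth `n ≤ k` and every plaquette `p ⊂ □̃^{(k−n)}`,
`|Ū₀^{k−n}(∂p) − 1| < 2α₀L²·L^{−2n}`.  Proof: the clamped extension (`B7Prop1Local.clampCfg`) of `U₀|□̃`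
satisfies (1.7) everywhere, `ineq128_global` applies to it, and its averages agree with those of `U₀` on the
tower (`agree_level`) — the printed locality of (43). [cite: Balaban1985RegularSpaces, (1.128) p.98;
Balaban1985Averaging, Prop. 2 p.26 (locality sentence)] -/
theorem ineq128_local (L : ℕ) (hL : 2 ≤ L) {G : Subgroup 𝔸ˣ} (hG : AvgClosed d L G) (k : ℕ)
    (U : Site d → Fin d → 𝔸ˣ) (hU : ∀ x κ, U x κ ∈ G) {α₀ : ℝ} (hα : 0 < α₀)
    (hα3 : C0 d * (α₀ * (L : ℝ) ^ 2) ≤ 1 / 3) (hα2 : 2 * (α₀ * (L : ℝ) ^ 2) ≤ c2' d L)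
    (lo hi : Site d) (hlohi : lo ≤ hi)
    (h17 : pdevOn (tlo L lo k) (thi L hi k) U < α₀ * (L : ℝ) ^ 2 * (((L : ℝ) ^ k)⁻¹) ^ 2)
    (n : ℕ) (hn : n ≤ k) (z : Site d) (μ ν : Fin d) (hz : tlo L lo n ≤ z) (hz' : z + e μ + e ν ≤ thi L hi n) :
    ‖((hol (avgIter L U (k - n)) z (plaqWord μ ν) : 𝔸ˣ) : 𝔸) - 1‖ < aLev α₀ L n := by
  have hL1 : 1 ≤ L := le_trans (by norm_num) hL
  have hUU : ∀ x κ, U x κ ∈ U1 𝔸 := fun x κ => hG.le_U1 (hU x κ)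
  have hkk : ∀ i, tlo L lo k i ≤ thi L hi k i := tlo_le_thi hL1 hlohi k
  have hU' : ∀ x κ, clampCfg (tlo L lo k) (thi L hi k) U x κ ∈ G := clampCfg_mem hU
  have h17' : pdev (clampCfg (tlo L lo k) (thi L hi k) U) < α₀ * (L : ℝ) ^ 2 * (((L : ℝ) ^ k)⁻¹) ^ 2 :=
    (pdev_clampCfg_le hkk hUU).trans_lt h17
  have h128 := ineq128_global L hL hG k _ hU' hα hα3 hα2 h17' n hn
  have hW : ∀ x κ, avgIter L (clampCfg (tlo L lo k) (thi L hi k) U) (k - n) x κ ∈ U1 𝔸 := fun x κ =>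
    hG.le_U1 (h128.2 (k - n) le_rfl x κ)
  have hag : AgreeOn (tlo L lo n) (thi L hi n) (avgIter L (clampCfg (tlo L lo k) (thi L hi k) U) (k - n))
      (avgIter L U (k - n)) :=
    agree_level hL1 (k - n) n (by rw [show n + (k - n) = k by omega]; exact clampCfg_agree U)
  have hzz : z ≤ z + e μ + e ν := (le_add_of_nonneg_right (e_nonneg μ)).trans (le_add_of_nonneg_right (e_nonneg ν))
  rw [← hol_plaqWord_congr hag z μ ν (inBox_of_le hz (hzz.trans hz')) (inBox_of_le (hz.trans hzz) hz')]
  exact (le_pdev hW z μ ν).trans_lt h128.1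

/-- **(1.130), FIRST MEMBER, LOCAL CARRIER** — as `ineq130_global`, but with (1.7) assumed on the unit plaquettes of
the cube `□̃` ONLY (`pdevOn` over `[tlo k, thi k]`; print: "Let us consider the configuration `U₀` on the cube `□̃`"
and "`□̃ ⊂ Ω_{k−1}`"): for every `n ≤ k` and every bond `⟨x, x + e_ν⟩ ⊂ □̃^{(k−n)}`,
`|Ū₀′^{k−n}(x, x + e_ν) − 1| ≤ 8d²L²(Σ_{m<n} L^{−2m})α₀ + (M + 4R₁M₁)dL²α₀`.  Proof: the clamped extension of
`U₀′|□̃` satisfies every hypothesis of `ineq130_global` ((1.15) and the global axial gauge transfer by the locality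
of transport and of (43) on the tower, `agree_level`), and its averages agree with those of `U₀′` on the tower.
[cite: Balaban1985RegularSpaces, (1.130) p.99, p.98] -/
theorem ineq130_local (L : ℕ) (hL : 2 ≤ L) (hd : 1 ≤ d) {G : Subgroup 𝔸ˣ} (hG : AvgClosed d L G) (k : ℕ)
    (U : Site d → Fin d → 𝔸ˣ) (hU : ∀ x κ, U x κ ∈ G) {α₀ : ℝ} (hα : 0 < α₀)
    (hα3 : C0 d * (α₀ * (L : ℝ) ^ 2) ≤ 1 / 3) (hα2 : 2 * (α₀ * (L : ℝ) ^ 2) ≤ c2' d L)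
    (lo hi : Site d) (hlohi : lo ≤ hi)
    (h17 : pdevOn (tlo L lo k) (thi L hi k) U < α₀ * (L : ℝ) ^ 2 * (((L : ℝ) ^ k)⁻¹) ^ 2)
    (h15 : ∀ n, n < k → ∀ z, tlo L lo n ≤ z → z ≤ thi L hi n → ∀ r : Fin d → Fin L,
      axialFn (avgIter L U (k - (n + 1))) ((L : ℤ) • z) ((L : ℤ) • z + boxVec L r) = 1)
    {y : Site d} {h : ℕ} (hy : lo ≤ y) (hy' : y ≤ hi) (hrad : ∀ κ, y κ - lo κ ≤ h ∧ hi κ - y κ ≤ h)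
    (hgax : ∀ z, lo ≤ z → z ≤ hi → hol (avgIter L U k) y (treeWord (z - y)) = 1)
    {M R₁ M₁ : ℝ} (hside : 2 * (h : ℝ) ≤ M + 4 * R₁ * M₁)
    (hsmall : 11 * (d : ℝ) ^ 2 * (L : ℝ) ^ 2 * α₀ + (M + 4 * R₁ * M₁) * d * (L : ℝ) ^ 2 * α₀ ≤ 1 / 6)
    (n : ℕ) (hn : n ≤ k) (x : Site d) (ν : Fin d) (hx : tlo L lo n ≤ x) (hxν : x + e ν ≤ thi L hi n) :
    ‖((avgIter L U (k - n) x ν : 𝔸ˣ) : 𝔸) - 1‖ ≤ bound130 d L α₀ M R₁ M₁ n := by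
  have hL1 : 1 ≤ L := le_trans (by norm_num) hL
  have hUU : ∀ x κ, U x κ ∈ U1 𝔸 := fun x κ => hG.le_U1 (hU x κ)
  have hkk : ∀ i, tlo L lo k i ≤ thi L hi k i := tlo_le_thi hL1 hlohi k
  have hU' : ∀ x κ, clampCfg (tlo L lo k) (thi L hi k) U x κ ∈ G := clampCfg_mem hU
  have h17' : pdev (clampCfg (tlo L lo k) (thi L hi k) U) < α₀ * (L : ℝ) ^ 2 * (((L : ℝ) ^ k)⁻¹) ^ 2 :=
    (pdev_clampCfg_le hkk hUU).trans_lt h17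
  have hA : ∀ j m, m + j = k → AgreeOn (tlo L lo m) (thi L hi m)
      (avgIter L (clampCfg (tlo L lo k) (thi L hi k) U) j) (avgIter L U j) := fun j m hmj =>
    agree_level hL1 j m (by rw [hmj]; exact clampCfg_agree U)
  have h15' : ∀ n, n < k → ∀ z, tlo L lo n ≤ z → z ≤ thi L hi n → ∀ r : Fin d → Fin L,
      axialFn (avgIter L (clampCfg (tlo L lo k) (thi L hi k) U) (k - (n + 1))) ((L : ℤ) • z)
        ((L : ℤ) • z + boxVec L r) = 1 := by
    intro n hn z hz hz' r
    obtain ⟨h1, h2⟩ := block_mem hz hz' r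
    obtain ⟨h3, h4⟩ := smul_mem hL1 hz hz'
    rw [axialFn_congr (hA (k - (n + 1)) (n + 1) (by omega)) _ _ (inBox_of_le h3 h4) (inBox_of_le h1 h2)]
    exact h15 n hn z hz hz' r
  have hgax' : ∀ z, lo ≤ z → z ≤ hi →
      hol (avgIter L (clampCfg (tlo L lo k) (thi L hi k) U) k) y (treeWord (z - y)) = 1 := by
    intro z hz hz'
    have hag := hA k 0 (by simp)
    rw [hol_treeWord_congr hag y (z - y) (inBox_of_le hy hy') (by rw [add_sub_cancel]; exact inBox_of_le hz hz')]
    exact hgax z hz hz'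
  have hmain := ineq130_global L hL hd hG k _ hU' hα hα3 hα2 h17' lo hi h15' hy hy' hrad hgax' hside hsmall
    n hn x ν hx hxν
  rwa [hA (k - n) n (by omega) x ν (inBox_of_le hx (le_of_add_e_le hxν))
    (inBox_of_le (hx.trans (le_add_of_nonneg_right (e_nonneg ν))) hxν)] at hmain

/-- **(1.130) ALL THREE MEMBERS, LOCAL CARRIER, printed constants**: under the hypotheses of `ineq130_local` and
`R₁M₁ ≤ M`, `11d < M` (p. 98: "`M` is a multiple of `R₁M₁`", "`α₀ ≤ O(1)M⁻¹`"), for every `n ≤ k` and every bond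
`⟨x, x + e_ν⟩ ⊂ □̃^{(k−n)}`: `|Ū₀′^{k−n}(x, x+e_ν) − 1| ≤ 8d²L²(Σ_{m<n}L^{−2m})α₀ + (M + 4R₁M₁)dL²α₀ <
11d²L²α₀ + 5dL²Mα₀ < 6dL²Mα₀` — in particular (1.133) `|Ū₀″ʲ − 1| < 6dL²Mα₀` on each `□̃^{(j)}`.
[cite: Balaban1985RegularSpaces, (1.130) p.99, (1.133) p.99] -/
theorem ineq130 (L : ℕ) (hL : 2 ≤ L) (hd : 1 ≤ d) {G : Subgroup 𝔸ˣ} (hG : AvgClosed d L G) (k : ℕ)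
    (U : Site d → Fin d → 𝔸ˣ) (hU : ∀ x κ, U x κ ∈ G) {α₀ : ℝ} (hα : 0 < α₀)
    (hα3 : C0 d * (α₀ * (L : ℝ) ^ 2) ≤ 1 / 3) (hα2 : 2 * (α₀ * (L : ℝ) ^ 2) ≤ c2' d L)
    (lo hi : Site d) (hlohi : lo ≤ hi)
    (h17 : pdevOn (tlo L lo k) (thi L hi k) U < α₀ * (L : ℝ) ^ 2 * (((L : ℝ) ^ k)⁻¹) ^ 2)
    (h15 : ∀ n, n < k → ∀ z, tlo L lo n ≤ z → z ≤ thi L hi n → ∀ r : Fin d → Fin L,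
      axialFn (avgIter L U (k - (n + 1))) ((L : ℤ) • z) ((L : ℤ) • z + boxVec L r) = 1)
    {y : Site d} {h : ℕ} (hy : lo ≤ y) (hy' : y ≤ hi) (hrad : ∀ κ, y κ - lo κ ≤ h ∧ hi κ - y κ ≤ h)
    (hgax : ∀ z, lo ≤ z → z ≤ hi → hol (avgIter L U k) y (treeWord (z - y)) = 1)
    {M R₁ M₁ : ℝ} (hside : 2 * (h : ℝ) ≤ M + 4 * R₁ * M₁) (hRM : R₁ * M₁ ≤ M) (hM : 11 * (d : ℝ) < M)
    (hsmall : 11 * (d : ℝ) ^ 2 * (L : ℝ) ^ 2 * α₀ + (M + 4 * R₁ * M₁) * d * (L : ℝ) ^ 2 * α₀ ≤ 1 / 6)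
    (n : ℕ) (hn : n ≤ k) (x : Site d) (ν : Fin d) (hx : tlo L lo n ≤ x) (hxν : x + e ν ≤ thi L hi n) :
    ‖((avgIter L U (k - n) x ν : 𝔸ˣ) : 𝔸) - 1‖ ≤ bound130 d L α₀ M R₁ M₁ n ∧
      bound130 d L α₀ M R₁ M₁ n < 11 * (d : ℝ) ^ 2 * (L : ℝ) ^ 2 * α₀ + 5 * d * (L : ℝ) ^ 2 * M * α₀ ∧
      11 * (d : ℝ) ^ 2 * (L : ℝ) ^ 2 * α₀ + 5 * d * (L : ℝ) ^ 2 * M * α₀ < 6 * d * (L : ℝ) ^ 2 * M * α₀ ∧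
      ‖((avgIter L U (k - n) x ν : 𝔸ˣ) : 𝔸) - 1‖ < 6 * d * (L : ℝ) ^ 2 * M * α₀ := by
  have h1 := ineq130_local L hL hd hG k U hU hα hα3 hα2 lo hi hlohi h17 h15 hy hy' hrad hgax hside hsmall
    n hn x ν hx hxν
  have h2 := ineq130_members hd hL hα hRM hM n
  exact ⟨h1, h2.1, h2.2, lt_of_le_of_lt h1 (h2.1.trans h2.2)⟩

end Local

end Literature.MathematicalPhysics.QuantumFieldTheory.Balaban1983to89.B8Ineq130

end
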